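/-
Copyright (c) 2026 the pub-hodgecm-mathlib formalisation cell (harness21).  Prover seat hodgecm-mathlib-LH7-p10 (g0), req620 Track A «(D-RAM) FOUR-FRAME» squad
(STAGE-1b, row (2) of the piece `f_{T₊}`, the (β₂) road (R-36); β₂ sub-dealer LH4-p04 (g8) COVERAGE CHECK 16:09:32Z item (2) «every cone cell of the box needs a ZERO or a
VALUE» — the census half: which cells are EMPTY; sequel of ★ p861408 ∕ p861491 ∕ p861594 ∕ p861746), 2026-09-04.
-/
import Summits.HodgeConjecture.HodgeConjecture.Theorems.F0P3cDyRamConeCellBoundaryEmptyAtTwo   -- ★ p861746 (this seat): §0 `…eq_zero_of_eq_empty`, `levelSetDep_eq_empty_of_levelSet_eq_empty`, `levelSet_eq_empty_of_ncard_eq_zero`; brings ★ p861408 (RamK readers, depth), ★ p861491 (RamM)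
import Summits.HodgeConjecture.HodgeConjecture.Theorems.F0P3cDyRamConeCellLedgerSizesUnrK       -- ★ p861594 (this seat): Unr-K readers
import HarnessLib

/-!
# Crux `H413`, line LH4 «(D-RAM) FOUR-FRAME» — STAGE-1b, row (2), the (β₂) road (R-36): «THE EMPTY-CELL ATLAS» — every cone cell `(j, b)`, `b ≥ 1`, of the `beta2Cells` box
# that carries NO plane lattice is `∅` (hence its `cellDiff` is `0` by ★ p861746 §0), lane by lane, from ★ T5a∕T5b∕T5c only

Cell `hodgecm-mathlib` (D-0151), FLOOR 0, crux item H413 = `stmt-HodgeConjecture-24833`, route of record `HCCMUnconditional`; squad F0∕P3c∕LH4; lane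
`--supports stmt-HodgeConjecture-24833 --as helper` (count-neutral; pays NO tier-0 row).  THEOREMS ONLY (no `def`, no instance, no notation, no `sorry`, default heartbeats);
★-only imports; states NO law; (β₂) stays a HYPOTHESIS.

WHY (β₂ sub-dealer LH4-p04 (g8) 16:09:32Z (2)).  The cell-sum identity behind `beta2Cells` (★ p861441 ∕ p861618) runs over the WHOLE box `range(J+1) × [1, R_t]` of cone cells; (L-Σ)
needs, for every cell off the pure list, `cellDiff_t(j, b) = 0` — by BALANCE when the cell is populated (LH7-p09 (g0)'s (L-P) half: faces ∕ exchanges) and TRIVIALLY when it is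
EMPTY.  THIS FILE is the census half: the empty cells, as `levelSetDep … = ∅` statements (each becomes `cellDiff = 0` for ANY labels and weight by ★ p861746
`finsum_inter_sub_finsum_inter_eq_zero_of_eq_empty`, and `levelSet = ∅ ⇒ levelSetDep(·; μ) = ∅` for EVERY `μ` by ★ p861746 `levelSetDep_eq_empty_of_levelSet_eq_empty`):
* §1 M∕E-UNRAMIFIED ONE-FIELD FRAME (RamK and Unr-K lanes; tokens `|μ| = exp(−m)`, `|μ − ρμ| = exp(−jλ)`): (∅-1) `levelSetDep_eq_empty_of_top_offDiag` — TOP OFF-DIAGONAL cells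
  `m < 2b`, `j + m ≠ jλ + b` (★ (R1-OFF) else-branch); with its `cellDiff` form; (∅-2) = ★ p861408 `levelSetDep_eq_empty_of_lt_add` (low cells beyond range) with its `cellDiff`
  form `cellDiff_eq_zero_of_lt_add`.
* §2 RamK u-FREE ZERO ROWS (★ p857929 tables at the frame ⇒ count `0` ⇒ finite ⇒ `∅`, either literal unless said): `j < b` (`levelSet_eq_empty_of_lt_ramK`), `b ≤ j` with `(j − b)`
  odd (`…_of_odd_ramK`), and the ANISOTROPIC far rows `b + 2d ≤ j` (`levelSet_far_ramK_aniso_eq_empty`).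
* §3 Unr-K u-FREE ZERO ROWS (★ p861594 readers): HYP `j < b + d` ∕ `(j − b − d)` odd, ANISO `b + d ≠ j + 1`.
* §4 RamM FRAME (★ T5c tokens `|μ| = |ϖE|^m`, `|μ − ρμ| = |ϖE^{jl}(ϖM − ρϖM)|`): (∅-1)_RamM `levelSetDep_eq_empty_of_top_offDiag_ramM` (`m < 2b`, `b ≤ j ≤ jl`, off-diagonal; ★
  `levelSetDep_eq_of_generic_ramified` else-branch), (∅-2)_RamM = ★ p861491 `levelSetDep_eq_empty_of_lt_add_ramM`, and the u-free zero rows `j < b`, `j − b + 1 < s0`, `k` odd,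
  ANISO far (★ p861491 tables at the frame).
WHAT IS NOT EMPTY AND NOT ON THE PURE LEDGER (→ (L-P)'s BALANCED list, sizes by name from ★ p861408 ∕ p861491 ∕ p861594): the low in-range rows with a non-zero table entry off the
pure list (near rows, the `c = δ` top-of-tower cell, the HYP boundary cell B at `q ≥ 4`, …) and the TOP DIAGONAL cells `m < 2b`, `j + m = jλ + b` (★ (R1-TOP) counts).
HONEST LABEL.  Count-neutral index bookkeeping over ★ tables; nothing printed is asserted; no census law is stated; (β₂) the LETTER UNPROVED; `HC_CM` is proved only modulo the 7 printed
citations (2 remaining named inputs: hLiu418 = `stmt-HodgeConjecture-24832`, h413 = `stmt-HodgeConjecture-24833`) until rung 0 closes.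
## References
* [Kottwitz1986BaseChangeUnits] R. E. Kottwitz, *Base change for unit elements of Hecke algebras*, Compositio Math. 60 (1986), §1 pp. 240–241.
* [Flicker1998UnitaryFL] Y. Z. Flicker, *Elementary proof of the fundamental lemma for a unitary group*, Canad. J. Math. 50 (1998), Prop. 7 p. 84.
* [Jacobowitz1962] R. Jacobowitz, *Hermitian forms over local fields*, Amer. J. Math. 84 (1962), §4.
* [Serre1979] J.-P. Serre, *Local Fields*, GTM 67 (1979), Ch. V §3 Prop. 5, Cor. 2–3 pp. 84–86.
-/

set_option autoImplicit false

noncomputable section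

open scoped Valued Classical
open WithZero IsLocalRing
open Literature.NumberTheory.Automorphic.UnitaryThreeFourFrame (IsRamifiedQuadraticDatum)
open Summit.HodgeConjecture.HodgeConjecture.Cruxes.H413.F0P3cDyRamToricCensusDefs
open Summit.HodgeConjecture.HodgeConjecture.Cruxes.H413.F0P3cDyRamToricLevelCensusUnr (levelSetDep_eq_of_offDiag)
open Summit.HodgeConjecture.HodgeConjecture.Cruxes.H413.F0P3cDyRamToricLevelCensusRamM (levelSetDep_eq_of_generic_ramified)
open Summit.HodgeConjecture.HodgeConjecture.Cruxes.H413.F0P3cDyRamToricLevelCensusRamKAtThirdField (ncard_levelSet_ramK_hyper_of_frame ncard_levelSet_ramK_aniso_of_frame)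
open Summit.HodgeConjecture.HodgeConjecture.Cruxes.H413.F0P3cDyRamConeCellLedgerSizes (levelSetDep_eq_empty_of_lt_add ncard_levelSet_far_ramK_aniso)
open Summit.HodgeConjecture.HodgeConjecture.Cruxes.H413.F0P3cDyRamConeCellLedgerSizesRamM (ncard_levelSet_ramM_hyper_of_frame ncard_levelSet_ramM_aniso_of_frame)
open Summit.HodgeConjecture.HodgeConjecture.Cruxes.H413.F0P3cDyRamConeCellLedgerSizesUnrK
open Summit.HodgeConjecture.HodgeConjecture.Cruxes.H413.F0P3cDyRamConeCellBoundaryEmptyAtTwo (finsum_inter_sub_finsum_inter_eq_zero_of_eq_empty levelSet_eq_empty_of_ncard_eq_zero)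

namespace Summit.HodgeConjecture.HodgeConjecture.Cruxes.H413.F0P3cDyRamConeCellEmptyAtlas

/-! ## §1 M∕E-unramified one-field frame (RamK ∕ Unr-K lanes): top off-diagonal cells and low cells beyond range -/

section Unramified

variable {K : Type*} [Field K] [Valued K ℤᵐ⁰] {ρ Θ : K →+* K} {α ϖE h : K}

/-- **(∅-1) TOP OFF-DIAGONAL CELLS ARE EMPTY**: in the one-field T5a frame with tokens `|μ| = exp(−m)`, `|μ − ρμ| = exp(−jλ)`, a tube depth `b ≥ 1` with `m < 2b` off the T5a diagonal
(`j + m ≠ jλ + b`) carries no plane lattice: `levelSetDep ρ Θ α ϖE h j b μ = ∅` (★ (R1-OFF): the clause `2b ≤ m ∧ …` fails). [cite: Jacobowitz1962, §4] [cite: Kottwitz1986BaseChangeUnits, §1 pp. 240–241] -/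
theorem levelSetDep_eq_empty_of_top_offDiag (hρρ : ∀ x, ρ (ρ x) = x) (hvρ : ∀ x, Valued.v (ρ x) = Valued.v x) (hΘΘ : ∀ x, Θ (Θ x) = x)
    (hΘρ : ∀ x, Θ (ρ x) = ρ (Θ x)) (hvΘ : ∀ x, Valued.v (Θ x) = Valued.v x) (hα1 : Valued.v α ≤ 1) (hα : Valued.v (α - ρ α) = 1)
    (hρϖE : ρ ϖE = ϖE) (hϖE : Valued.v ϖE = exp (-1 : ℤ)) (hh : h ≠ 0)
    {μ : K} {m jl : ℕ} (hm : Valued.v μ = exp (-(m : ℤ))) (hjl : Valued.v (μ - ρ μ) = exp (-(jl : ℤ)))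
    {j b : ℕ} (hb : 1 ≤ b) (htop : m < 2 * b) (hoff : j + m ≠ jl + b) :
    levelSetDep ρ Θ α ϖE h j b μ = ∅ := by
  rw [levelSetDep_eq_of_offDiag hρρ hvρ hΘΘ hΘρ hvΘ hα1 hα hρϖE hϖE hh hm hjl hb hoff, if_neg (by omega)]

/-- (∅-1) in `cellDiff` form: for a top off-diagonal cell, `(Σᶠ_{cell ∩ P} f : ℤ) − Σᶠ_{cell ∩ Q} f = 0` for any labels and weight. [cite: Kottwitz1986BaseChangeUnits, §1 pp. 240–241] -/
theorem cellDiff_eq_zero_of_top_offDiag (hρρ : ∀ x, ρ (ρ x) = x) (hvρ : ∀ x, Valued.v (ρ x) = Valued.v x) (hΘΘ : ∀ x, Θ (Θ x) = x)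
    (hΘρ : ∀ x, Θ (ρ x) = ρ (Θ x)) (hvΘ : ∀ x, Valued.v (Θ x) = Valued.v x) (hα1 : Valued.v α ≤ 1) (hα : Valued.v (α - ρ α) = 1)
    (hρϖE : ρ ϖE = ϖE) (hϖE : Valued.v ϖE = exp (-1 : ℤ)) (hh : h ≠ 0)
    {μ : K} {m jl : ℕ} (hm : Valued.v μ = exp (-(m : ℤ))) (hjl : Valued.v (μ - ρ μ) = exp (-(jl : ℤ)))
    {j b : ℕ} (hb : 1 ≤ b) (htop : m < 2 * b) (hoff : j + m ≠ jl + b) (P Q : AddSubgroup K → Prop) (f : AddSubgroup K → ℕ) :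
    ((∑ᶠ Λ ∈ levelSetDep ρ Θ α ϖE h j b μ ∩ {Λ | P Λ}, f Λ : ℕ) : ℤ) - ((∑ᶠ Λ ∈ levelSetDep ρ Θ α ϖE h j b μ ∩ {Λ | Q Λ}, f Λ : ℕ) : ℤ) = 0 :=
  finsum_inter_sub_finsum_inter_eq_zero_of_eq_empty _ (levelSetDep_eq_empty_of_top_offDiag hρρ hvρ hΘΘ hΘρ hvΘ hα1 hα hρϖE hϖE hh hm hjl hb htop hoff) P Q f

/-- **(∅-2) in `cellDiff` form** (★ p861408 `levelSetDep_eq_empty_of_lt_add`): a low cell (`2b ≤ m`) beyond range (`m < j + b`, `jλ < j + b`) contributes `0`. [cite: Kottwitz1986BaseChangeUnits, §1 pp. 240–241] -/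
theorem cellDiff_eq_zero_of_lt_add (hρρ : ∀ x, ρ (ρ x) = x) (hvρ : ∀ x, Valued.v (ρ x) = Valued.v x) (hΘΘ : ∀ x, Θ (Θ x) = x)
    (hΘρ : ∀ x, Θ (ρ x) = ρ (Θ x)) (hvΘ : ∀ x, Valued.v (Θ x) = Valued.v x) (hα1 : Valued.v α ≤ 1) (hα : Valued.v (α - ρ α) = 1)
    (hρϖE : ρ ϖE = ϖE) (hϖE : Valued.v ϖE = exp (-1 : ℤ)) (hh : h ≠ 0)
    {μ : K} {m jl : ℕ} (hm : Valued.v μ = exp (-(m : ℤ))) (hjl : Valued.v (μ - ρ μ) = exp (-(jl : ℤ)))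
    {j b : ℕ} (hb : 1 ≤ b) (h2b : 2 * b ≤ m) (hmj : m < j + b) (hjlj : jl < j + b) (P Q : AddSubgroup K → Prop) (f : AddSubgroup K → ℕ) :
    ((∑ᶠ Λ ∈ levelSetDep ρ Θ α ϖE h j b μ ∩ {Λ | P Λ}, f Λ : ℕ) : ℤ) - ((∑ᶠ Λ ∈ levelSetDep ρ Θ α ϖE h j b μ ∩ {Λ | Q Λ}, f Λ : ℕ) : ℤ) = 0 :=
  finsum_inter_sub_finsum_inter_eq_zero_of_eq_empty _ (levelSetDep_eq_empty_of_lt_add hρρ hvρ hΘΘ hΘρ hvΘ hα1 hα hρϖE hϖE hh hm hjl hb h2b hmj hjlj) P Q f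

end Unramified

/-! ## §2 RamK lane: the u-free zero rows are empty (for every multiplier, by ★ p861746 `levelSetDep_eq_empty_of_levelSet_eq_empty`) -/

section RamK

variable {K : Type} [Field K] [Valued K ℤᵐ⁰] {ρ Θ : K →+* K} {α ϖE h : K}

/-- **RamK: `j < b` ⇒ `levelSet(j, b) = ∅`, EITHER LITERAL** (the order level below the tube depth carries nothing; frame of ★ p857929, `h` Θ-fixed non-zero).
[cite: Flicker1998UnitaryFL, Prop. 7 p. 84] [cite: Serre1979, Ch. V §3 Prop. 5, Cor. 2–3 pp. 84–86] -/
theorem levelSet_eq_empty_of_lt_ramK [CompleteSpace K] [IsDiscreteValuationRing 𝒪[K]] [Finite 𝓀[K]]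
    (hρρ : ∀ x, ρ (ρ x) = x) (hvρ : ∀ x, Valued.v (ρ x) = Valued.v x) (hΘρ : ∀ x, Θ (ρ x) = ρ (Θ x))
    (hα1 : Valued.v α ≤ 1) (hα : Valued.v (α - ρ α) = 1) {d t : ℕ} (hD : IsRamifiedQuadraticDatum Θ ϖE d t) (hρϖ : ρ ϖE = ϖE)
    (hΘh : Θ h = h) (hh : h ≠ 0) {q : ℕ} (hq : Nat.card 𝓀[K] = q ^ 2)
    (hσres : ∀ z : K, ρ z = z → Valued.v z ≤ 1 → Valued.v (Θ z - z) < 1) (hram : Valued.v (α - Θ α) < 1)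
    {j b : ℕ} (hlt : j < b) :
    levelSet ρ Θ α ϖE h j b = ∅ := by
  refine levelSet_eq_empty_of_ncard_eq_zero hvρ hD.2.1 ?_
  by_cases hiso : ∃ x : K, x ≠ 0 ∧ h * Θ x * x + ρ (h * Θ x * x) = 0
  · rw [ncard_levelSet_ramK_hyper_of_frame hρρ hvρ hΘρ hα1 hα hD hρϖ hΘh hh hq hσres hram hiso j b]
    by_cases hj0 : j = 0
    · rw [if_pos hj0, if_neg (by omega)]
    · rw [if_neg hj0, if_pos (Or.inl hlt)]
  · rw [ncard_levelSet_ramK_aniso_of_frame hρρ hvρ hΘρ hα1 hα hD hρϖ hΘh hh hq hσres hram hiso j b]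
    by_cases hj0 : j = 0
    · rw [if_pos hj0, if_neg (by omega)]
    · rw [if_neg hj0, if_pos (Or.inl hlt)]

/-- **RamK: `b ≤ j`, `(j − b)` odd ⇒ `levelSet(j, b) = ∅`, EITHER LITERAL** (the parity gate `j ≡ b (2)`). [cite: Flicker1998UnitaryFL, Prop. 7 p. 84] [cite: Serre1979, Ch. V §3 Prop. 5, Cor. 2–3 pp. 84–86] -/
theorem levelSet_eq_empty_of_odd_ramK [CompleteSpace K] [IsDiscreteValuationRing 𝒪[K]] [Finite 𝓀[K]]
    (hρρ : ∀ x, ρ (ρ x) = x) (hvρ : ∀ x, Valued.v (ρ x) = Valued.v x) (hΘρ : ∀ x, Θ (ρ x) = ρ (Θ x))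
    (hα1 : Valued.v α ≤ 1) (hα : Valued.v (α - ρ α) = 1) {d t : ℕ} (hD : IsRamifiedQuadraticDatum Θ ϖE d t) (hρϖ : ρ ϖE = ϖE)
    (hΘh : Θ h = h) (hh : h ≠ 0) {q : ℕ} (hq : Nat.card 𝓀[K] = q ^ 2)
    (hσres : ∀ z : K, ρ z = z → Valued.v z ≤ 1 → Valued.v (Θ z - z) < 1) (hram : Valued.v (α - Θ α) < 1)
    {j b : ℕ} (hbj : b ≤ j) (hodd : (j - b) % 2 = 1) :
    levelSet ρ Θ α ϖE h j b = ∅ := by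
  have hj0 : ¬ j = 0 := by omega
  refine levelSet_eq_empty_of_ncard_eq_zero hvρ hD.2.1 ?_
  by_cases hiso : ∃ x : K, x ≠ 0 ∧ h * Θ x * x + ρ (h * Θ x * x) = 0
  · rw [ncard_levelSet_ramK_hyper_of_frame hρρ hvρ hΘρ hα1 hα hD hρϖ hΘh hh hq hσres hram hiso j b, if_neg hj0, if_pos (Or.inr hodd)]
  · rw [ncard_levelSet_ramK_aniso_of_frame hρρ hvρ hΘρ hα1 hα hD hρϖ hΘh hh hq hσres hram hiso j b, if_neg hj0, if_pos (Or.inr hodd)]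

/-- **RamK: the ANISOTROPIC far rows are empty** — `1 ≤ b`, `b + 2d ≤ j`, `(j − b)` even ⇒ `levelSet(j, b) = ∅` at the anisotropic literal (★ p861408 `ncard_levelSet_far_ramK_aniso` = 0).
[cite: Flicker1998UnitaryFL, Prop. 7 p. 84] [cite: Serre1979, Ch. V §3 Prop. 5, Cor. 2–3 pp. 84–86] -/
theorem levelSet_far_ramK_aniso_eq_empty [CompleteSpace K] [IsDiscreteValuationRing 𝒪[K]] [Finite 𝓀[K]]
    (hρρ : ∀ x, ρ (ρ x) = x) (hvρ : ∀ x, Valued.v (ρ x) = Valued.v x) (hΘρ : ∀ x, Θ (ρ x) = ρ (Θ x))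
    (hα1 : Valued.v α ≤ 1) (hα : Valued.v (α - ρ α) = 1) {d t : ℕ} (hD : IsRamifiedQuadraticDatum Θ ϖE d t) (hρϖ : ρ ϖE = ϖE)
    (hΘh : Θ h = h) (hh : h ≠ 0) {q : ℕ} (hq : Nat.card 𝓀[K] = q ^ 2)
    (hσres : ∀ z : K, ρ z = z → Valued.v z ≤ 1 → Valued.v (Θ z - z) < 1) (hram : Valued.v (α - Θ α) < 1)
    (haniso : ¬ ∃ x : K, x ≠ 0 ∧ h * Θ x * x + ρ (h * Θ x * x) = 0)
    {j b : ℕ} (hb : 1 ≤ b) (hfar : b + 2 * d ≤ j) (hpar : (j - b) % 2 = 0) :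
    levelSet ρ Θ α ϖE h j b = ∅ :=
  levelSet_eq_empty_of_ncard_eq_zero hvρ hD.2.1
    (ncard_levelSet_far_ramK_aniso hρρ hvρ hΘρ hα1 hα hD hρϖ hΘh hh hq hσres hram haniso hb hfar hpar)

end RamK

/-! ## §3 Unr-K sub-lane: the u-free zero rows are empty -/

section UnrK

variable {K : Type} [Field K] [Valued K ℤᵐ⁰] {ρ Θ : K →+* K} {α ϖE h : K} {d q : ℕ}

/-- **Unr-K, HYPERBOLIC: below the tower (`1 ≤ b`, `j < b + d`) the cell is empty** (⊇ the empty diagonal of ★ p861334 §3). [cite: Flicker1998UnitaryFL, Prop. 7 p. 84] [cite: Serre1979, Ch. V §3 Prop. 5, Cor. 2–3 pp. 84–86] -/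
theorem levelSet_unrK_hyper_eq_empty_of_lt [CompleteSpace K] [IsDiscreteValuationRing 𝒪[K]] [Finite 𝓀[K]]
    (hρρ : ∀ x, ρ (ρ x) = x) (hvρ : ∀ x, Valued.v (ρ x) = Valued.v x) (hΘΘ : ∀ x, Θ (Θ x) = x) (hΘρ : ∀ x, Θ (ρ x) = ρ (Θ x))
    (hvΘ : ∀ x, Valued.v (Θ x) = Valued.v x) (hα1 : Valued.v α ≤ 1) (hα : Valued.v (α - ρ α) = 1)
    (hρϖE : ρ ϖE = ϖE) (hϖE : Valued.v ϖE = exp (-1 : ℤ)) (hq : Nat.card 𝓀[K] = q ^ 2)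
    (hτα : Valued.v (ρ α - Θ α) < 1) (hd : 1 ≤ d) (hddE : Valued.v (ϖE - Θ ϖE) = Valued.v ϖE ^ d)
    (hfixE : ∀ z : K, ρ z = z → Θ z = z → z ≠ 0 → ∃ n : ℤ, Valued.v z = exp (2 * n))
    (hΘh : Θ h = h) (hh : h ≠ 0) (hhyper : ∃ x : K, x ≠ 0 ∧ h * Θ x * x + ρ (h * Θ x * x) = 0)
    {j b : ℕ} (hb : 1 ≤ b) (hlt : j < b + d) :
    levelSet ρ Θ α ϖE h j b = ∅ :=
  levelSet_eq_empty_of_ncard_eq_zero hvρ hvΘ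
    (ncard_levelSet_unrK_hyper_eq_zero_of_lt hρρ hvρ hΘΘ hΘρ hvΘ hα1 hα hρϖE hϖE hq hτα hd hddE hfixE hΘh hh hhyper hb hlt)

/-- **Unr-K, HYPERBOLIC: at the wrong parity (`1 ≤ b`, `(j − b − d)` odd) the cell is empty.** [cite: Flicker1998UnitaryFL, Prop. 7 p. 84] [cite: Serre1979, Ch. V §3 Prop. 5, Cor. 2–3 pp. 84–86] -/
theorem levelSet_unrK_hyper_eq_empty_of_odd [CompleteSpace K] [IsDiscreteValuationRing 𝒪[K]] [Finite 𝓀[K]]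
    (hρρ : ∀ x, ρ (ρ x) = x) (hvρ : ∀ x, Valued.v (ρ x) = Valued.v x) (hΘΘ : ∀ x, Θ (Θ x) = x) (hΘρ : ∀ x, Θ (ρ x) = ρ (Θ x))
    (hvΘ : ∀ x, Valued.v (Θ x) = Valued.v x) (hα1 : Valued.v α ≤ 1) (hα : Valued.v (α - ρ α) = 1)
    (hρϖE : ρ ϖE = ϖE) (hϖE : Valued.v ϖE = exp (-1 : ℤ)) (hq : Nat.card 𝓀[K] = q ^ 2)
    (hτα : Valued.v (ρ α - Θ α) < 1) (hd : 1 ≤ d) (hddE : Valued.v (ϖE - Θ ϖE) = Valued.v ϖE ^ d)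
    (hfixE : ∀ z : K, ρ z = z → Θ z = z → z ≠ 0 → ∃ n : ℤ, Valued.v z = exp (2 * n))
    (hΘh : Θ h = h) (hh : h ≠ 0) (hhyper : ∃ x : K, x ≠ 0 ∧ h * Θ x * x + ρ (h * Θ x * x) = 0)
    {j b : ℕ} (hb : 1 ≤ b) (hodd : (j - b - d) % 2 = 1) :
    levelSet ρ Θ α ϖE h j b = ∅ :=
  levelSet_eq_empty_of_ncard_eq_zero hvρ hvΘ
    (ncard_levelSet_unrK_hyper_eq_zero_of_odd hρρ hvρ hΘΘ hΘρ hvΘ hα1 hα hρϖE hϖE hq hτα hd hddE hfixE hΘh hh hhyper hb hodd)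

/-- **Unr-K, ANISOTROPIC: off the head row (`1 ≤ b`, `b + d ≠ j + 1`) the cell is empty.** [cite: Flicker1998UnitaryFL, Prop. 7 p. 84] [cite: Serre1979, Ch. V §3 Prop. 5, Cor. 2–3 pp. 84–86] -/
theorem levelSet_unrK_aniso_eq_empty_of_ne [CompleteSpace K] [IsDiscreteValuationRing 𝒪[K]] [Finite 𝓀[K]]
    (hρρ : ∀ x, ρ (ρ x) = x) (hvρ : ∀ x, Valued.v (ρ x) = Valued.v x) (hΘΘ : ∀ x, Θ (Θ x) = x) (hΘρ : ∀ x, Θ (ρ x) = ρ (Θ x))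
    (hvΘ : ∀ x, Valued.v (Θ x) = Valued.v x) (hα1 : Valued.v α ≤ 1) (hα : Valued.v (α - ρ α) = 1)
    (hρϖE : ρ ϖE = ϖE) (hϖE : Valued.v ϖE = exp (-1 : ℤ)) (hq : Nat.card 𝓀[K] = q ^ 2)
    (hτα : Valued.v (ρ α - Θ α) < 1) (hd : 1 ≤ d) (hddE : Valued.v (ϖE - Θ ϖE) = Valued.v ϖE ^ d)
    (hfixE : ∀ z : K, ρ z = z → Θ z = z → z ≠ 0 → ∃ n : ℤ, Valued.v z = exp (2 * n))
    (hΘh : Θ h = h) (hh : h ≠ 0) (haniso : ¬ ∃ x : K, x ≠ 0 ∧ h * Θ x * x + ρ (h * Θ x * x) = 0)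
    {j b : ℕ} (hb : 1 ≤ b) (hne : b + d ≠ j + 1) :
    levelSet ρ Θ α ϖE h j b = ∅ :=
  levelSet_eq_empty_of_ncard_eq_zero hvρ hvΘ
    (ncard_levelSet_unrK_aniso_eq_zero_of_ne hρρ hvρ hΘΘ hΘρ hvΘ hα1 hα hρϖE hϖE hq hτα hd hddE hfixE hΘh hh haniso hb hne)

end UnrK

/-! ## §4 RamM lane: top off-diagonal cells, and the u-free zero rows -/

section RamM

variable {K : Type} [Field K] [Valued K ℤᵐ⁰] {ρ Θ : K →+* K}

/-- **(∅-1)_RamM TOP OFF-DIAGONAL CELLS ARE EMPTY**: in the T5c frame of ★ `levelSetDep_eq_of_generic_ramified` (ρ-datum `(ρ, ϖM, d_ρ)`, `Θ` an isometric involution commuting with `ρ`,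
`ρϖE = ϖE`, `|ϖE| = exp(−2)`, `h ≠ 0`; tokens `|μ| = |ϖE|^m`, `|μ − ρμ| = |ϖE^{jl}(ϖM − ρϖM)|`), for `b ≤ j ≤ jl` with `m < 2b` off the diagonal (`j + m ≠ jl + b`):
`levelSetDep(j, b; μ) = ∅` (the generic clause fails: `j ≤ m − b` would force `2b ≤ j + b ≤ m`). [cite: Jacobowitz1962, §4] [cite: Kottwitz1986BaseChangeUnits, §1 pp. 240–241] -/
theorem levelSetDep_eq_empty_of_top_offDiag_ramM {ϖM ϖE h : K} {dρ t : ℕ} (hDρ : IsRamifiedQuadraticDatum ρ ϖM dρ t)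
    (hΘΘ : ∀ x, Θ (Θ x) = x) (hΘρ : ∀ x, Θ (ρ x) = ρ (Θ x)) (hvΘ : ∀ x, Valued.v (Θ x) = Valued.v x)
    (hρϖ : ρ ϖE = ϖE) (hϖE : Valued.v ϖE = exp (-2 : ℤ)) (hh : h ≠ 0)
    {μ : K} {m jl : ℕ} (hμ : Valued.v μ = Valued.v ϖE ^ m) (hjl : Valued.v (μ - ρ μ) = Valued.v (ϖE ^ jl * (ϖM - ρ ϖM)))
    {j b : ℕ} (hbj : b ≤ j) (hj : j ≤ jl) (htop : m < 2 * b) (hoff : j + m ≠ jl + b) :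
    levelSetDep ρ Θ ϖM ϖE h j b μ = ∅ := by
  rw [levelSetDep_eq_of_generic_ramified hDρ hΘΘ hΘρ hvΘ hρϖ hϖE hh hμ hjl hj (Or.inl hoff), if_neg (by omega)]

/-- **RamM: `j < b` ⇒ `levelSet(j, b) = ∅`, EITHER LITERAL** (frame of ★ p861491's tables at the frame; `h` Θ-fixed non-zero). [cite: Flicker1998UnitaryFL, Prop. 7 p. 84] [cite: Serre1979, Ch. V §3 Prop. 5, Cor. 2–3 pp. 84–86] -/
theorem levelSet_eq_empty_of_lt_ramM [CompleteSpace K] [IsDiscreteValuationRing 𝒪[K]] [Finite 𝓀[K]]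
    (hρρ : ∀ x, ρ (ρ x) = x) (hvρ : ∀ x, Valued.v (ρ x) = Valued.v x)
    (hΘΘ : ∀ x, Θ (Θ x) = x) (hΘρ : ∀ x, Θ (ρ x) = ρ (Θ x)) (hvΘ : ∀ x, Valued.v (Θ x) = Valued.v x)
    (hΘres : ∀ x : K, Valued.v x ≤ 1 → Valued.v (x - Θ x) < 1)
    {ϖM : K} (hϖM : Valued.v ϖM = exp (-1 : ℤ)) {dρ dΘ t : ℕ}
    (hDρ : IsRamifiedQuadraticDatum ρ ϖM dρ t) (hDΘ : IsRamifiedQuadraticDatum Θ ϖM dΘ t)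
    (hF4 : ∀ z : K, ρ z = z → Θ z = z → z ≠ 0 → ∃ n : ℤ, Valued.v z = exp (4 * n))
    (hFN : ∀ f : K, ρ f = f → Θ f = f → Valued.v f = 1 → ∃ z : K, z * Θ z = f)
    {c₀ : K} (hc₀ : Valued.v c₀ = 1) (hdich : ∀ u : K, Θ u = u → Valued.v u = 1 → (∃ z : K, z * Θ z = u) ∨ ∃ z : K, z * Θ z = c₀ * u)
    {n₀ : K} (hΘn₀ : Θ n₀ = n₀) (hn₀1 : Valued.v n₀ = 1) (hn₀N : ¬ ∃ z : K, z * Θ z = n₀)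
    {ϖE : K} (hϖE : Valued.v ϖE = exp (-2 : ℤ)) (hρϖ : ρ ϖE = ϖE)
    {q : ℕ} (hq : Nat.card 𝓀[K] = q) (hq2 : 2 ∣ q)
    {g s0 d' : ℕ} (hg2 : dΘ = 2 * g) (hs01 : 1 ≤ s0)
    (hd'v : Valued.v (ϖM * Θ ϖM - ρ (ϖM * Θ ϖM)) = exp (-(2 * (d' : ℤ)))) (hds : 2 * d' = dρ + 2 * s0)
    {h : K} (hΘh : Θ h = h) (hh : h ≠ 0) {vh e : ℤ} (hvh : Valued.v h = exp (-vh)) (he : vh + dρ = 2 * e)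
    {j b : ℕ} (hlt : j < b) :
    levelSet ρ Θ ϖM ϖE h j b = ∅ := by
  refine levelSet_eq_empty_of_ncard_eq_zero hvρ hvΘ ?_
  by_cases hiso : ∃ x : K, x ≠ 0 ∧ h * Θ x * x + ρ (h * Θ x * x) = 0
  · rw [ncard_levelSet_ramM_hyper_of_frame hρρ hvρ hΘΘ hΘρ hvΘ hΘres hϖM hDρ hDΘ hF4 hFN hϖE hρϖ hq hq2 hg2 hs01 hd'v hds hΘh hh hiso hvh he j b]
    by_cases hj0 : j = 0
    · rw [if_pos hj0, if_neg (by omega)]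
    · rw [if_neg hj0, if_pos hlt]
  · rw [ncard_levelSet_ramM_aniso_of_frame hρρ hvρ hΘΘ hΘρ hvΘ hΘres hϖM hDρ hDΘ hF4 hFN hc₀ hdich hΘn₀ hn₀1 hn₀N hϖE hρϖ hq hg2 hs01 hd'v hds hΘh hh hiso
        hvh he j b]
    by_cases hj0 : j = 0
    · rw [if_pos hj0, if_neg (by omega)]
    · rw [if_neg hj0, if_pos hlt]

/-- **RamM: `1 ≤ b ≤ j`, `j − b + 1 < s0` (`k ≤ −2`) ⇒ `levelSet(j, b) = ∅`, EITHER LITERAL.** [cite: Flicker1998UnitaryFL, Prop. 7 p. 84] [cite: Serre1979, Ch. V §3 Prop. 5, Cor. 2–3 pp. 84–86] -/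
theorem levelSet_eq_empty_of_shallow_ramM [CompleteSpace K] [IsDiscreteValuationRing 𝒪[K]] [Finite 𝓀[K]]
    (hρρ : ∀ x, ρ (ρ x) = x) (hvρ : ∀ x, Valued.v (ρ x) = Valued.v x)
    (hΘΘ : ∀ x, Θ (Θ x) = x) (hΘρ : ∀ x, Θ (ρ x) = ρ (Θ x)) (hvΘ : ∀ x, Valued.v (Θ x) = Valued.v x)
    (hΘres : ∀ x : K, Valued.v x ≤ 1 → Valued.v (x - Θ x) < 1)
    {ϖM : K} (hϖM : Valued.v ϖM = exp (-1 : ℤ)) {dρ dΘ t : ℕ}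
    (hDρ : IsRamifiedQuadraticDatum ρ ϖM dρ t) (hDΘ : IsRamifiedQuadraticDatum Θ ϖM dΘ t)
    (hF4 : ∀ z : K, ρ z = z → Θ z = z → z ≠ 0 → ∃ n : ℤ, Valued.v z = exp (4 * n))
    (hFN : ∀ f : K, ρ f = f → Θ f = f → Valued.v f = 1 → ∃ z : K, z * Θ z = f)
    {c₀ : K} (hc₀ : Valued.v c₀ = 1) (hdich : ∀ u : K, Θ u = u → Valued.v u = 1 → (∃ z : K, z * Θ z = u) ∨ ∃ z : K, z * Θ z = c₀ * u)
    {n₀ : K} (hΘn₀ : Θ n₀ = n₀) (hn₀1 : Valued.v n₀ = 1) (hn₀N : ¬ ∃ z : K, z * Θ z = n₀)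
    {ϖE : K} (hϖE : Valued.v ϖE = exp (-2 : ℤ)) (hρϖ : ρ ϖE = ϖE)
    {q : ℕ} (hq : Nat.card 𝓀[K] = q) (hq2 : 2 ∣ q)
    {g s0 d' : ℕ} (hg2 : dΘ = 2 * g) (hs01 : 1 ≤ s0)
    (hd'v : Valued.v (ϖM * Θ ϖM - ρ (ϖM * Θ ϖM)) = exp (-(2 * (d' : ℤ)))) (hds : 2 * d' = dρ + 2 * s0)
    {h : K} (hΘh : Θ h = h) (hh : h ≠ 0) {vh e : ℤ} (hvh : Valued.v h = exp (-vh)) (he : vh + dρ = 2 * e)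
    {j b : ℕ} (hb : 1 ≤ b) (hbj : b ≤ j) (hsh : j - b + 1 < s0) :
    levelSet ρ Θ ϖM ϖE h j b = ∅ := by
  refine levelSet_eq_empty_of_ncard_eq_zero hvρ hvΘ ?_
  by_cases hiso : ∃ x : K, x ≠ 0 ∧ h * Θ x * x + ρ (h * Θ x * x) = 0
  · rw [ncard_levelSet_ramM_hyper_of_frame hρρ hvρ hΘΘ hΘρ hvΘ hΘres hϖM hDρ hDΘ hF4 hFN hϖE hρϖ hq hq2 hg2 hs01 hd'v hds hΘh hh hiso hvh he j b,
      if_neg (by omega), if_neg (by omega), if_neg (by omega), if_pos hsh, if_neg (by omega)]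
  · rw [ncard_levelSet_ramM_aniso_of_frame hρρ hvρ hΘΘ hΘρ hvΘ hΘres hϖM hDρ hDΘ hF4 hFN hc₀ hdich hΘn₀ hn₀1 hn₀N hϖE hρϖ hq hg2 hs01 hd'v hds hΘh hh hiso
        hvh he j b,
      if_neg (by omega), if_neg (by omega), if_neg (by omega), if_pos hsh, if_neg (by omega)]

/-- **RamM: `1 ≤ b`, `b + s0 ≤ j`, `k = j − b − s0` odd ⇒ `levelSet(j, b) = ∅`, EITHER LITERAL** (the odd class is dead). [cite: Flicker1998UnitaryFL, Prop. 7 p. 84] [cite: Serre1979, Ch. V §3 Prop. 5, Cor. 2–3 pp. 84–86] -/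
theorem levelSet_eq_empty_of_odd_ramM [CompleteSpace K] [IsDiscreteValuationRing 𝒪[K]] [Finite 𝓀[K]]
    (hρρ : ∀ x, ρ (ρ x) = x) (hvρ : ∀ x, Valued.v (ρ x) = Valued.v x)
    (hΘΘ : ∀ x, Θ (Θ x) = x) (hΘρ : ∀ x, Θ (ρ x) = ρ (Θ x)) (hvΘ : ∀ x, Valued.v (Θ x) = Valued.v x)
    (hΘres : ∀ x : K, Valued.v x ≤ 1 → Valued.v (x - Θ x) < 1)
    {ϖM : K} (hϖM : Valued.v ϖM = exp (-1 : ℤ)) {dρ dΘ t : ℕ}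
    (hDρ : IsRamifiedQuadraticDatum ρ ϖM dρ t) (hDΘ : IsRamifiedQuadraticDatum Θ ϖM dΘ t)
    (hF4 : ∀ z : K, ρ z = z → Θ z = z → z ≠ 0 → ∃ n : ℤ, Valued.v z = exp (4 * n))
    (hFN : ∀ f : K, ρ f = f → Θ f = f → Valued.v f = 1 → ∃ z : K, z * Θ z = f)
    {c₀ : K} (hc₀ : Valued.v c₀ = 1) (hdich : ∀ u : K, Θ u = u → Valued.v u = 1 → (∃ z : K, z * Θ z = u) ∨ ∃ z : K, z * Θ z = c₀ * u)
    {n₀ : K} (hΘn₀ : Θ n₀ = n₀) (hn₀1 : Valued.v n₀ = 1) (hn₀N : ¬ ∃ z : K, z * Θ z = n₀)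
    {ϖE : K} (hϖE : Valued.v ϖE = exp (-2 : ℤ)) (hρϖ : ρ ϖE = ϖE)
    {q : ℕ} (hq : Nat.card 𝓀[K] = q) (hq2 : 2 ∣ q)
    {g s0 d' : ℕ} (hg2 : dΘ = 2 * g) (hs01 : 1 ≤ s0)
    (hd'v : Valued.v (ϖM * Θ ϖM - ρ (ϖM * Θ ϖM)) = exp (-(2 * (d' : ℤ)))) (hds : 2 * d' = dρ + 2 * s0)
    {h : K} (hΘh : Θ h = h) (hh : h ≠ 0) {vh e : ℤ} (hvh : Valued.v h = exp (-vh)) (he : vh + dρ = 2 * e)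
    {j b : ℕ} (hb : 1 ≤ b) (hk : b + s0 ≤ j) (hodd : (j - b - s0) % 2 = 1) :
    levelSet ρ Θ ϖM ϖE h j b = ∅ := by
  refine levelSet_eq_empty_of_ncard_eq_zero hvρ hvΘ ?_
  by_cases hiso : ∃ x : K, x ≠ 0 ∧ h * Θ x * x + ρ (h * Θ x * x) = 0
  · rw [ncard_levelSet_ramM_hyper_of_frame hρρ hvρ hΘΘ hΘρ hvΘ hΘres hϖM hDρ hDΘ hF4 hFN hϖE hρϖ hq hq2 hg2 hs01 hd'v hds hΘh hh hiso hvh he j b,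
      if_neg (by omega), if_neg (by omega), if_neg (by omega), if_neg (by omega), if_pos hodd]
  · rw [ncard_levelSet_ramM_aniso_of_frame hρρ hvρ hΘΘ hΘρ hvΘ hΘres hϖM hDρ hDΘ hF4 hFN hc₀ hdich hΘn₀ hn₀1 hn₀N hϖE hρϖ hq hg2 hs01 hd'v hds hΘh hh hiso
        hvh he j b,
      if_neg (by omega), if_neg (by omega), if_neg (by omega), if_neg (by omega), if_pos hodd]

end RamM

end Summit.HodgeConjecture.HodgeConjecture.Cruxes.H413.F0P3cDyRamConeCellEmptyAtlas

end
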